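import Literature.NumberTheory.EllipticCurves.Wuthrich2014.PAdicBSDInequalityProofs
import Literature.NumberTheory.EllipticCurves.Rank1Residual.Typed.KolyvaginCertificate
import HarnessLib

/-!
# The `p`-adic certificate engine: `Ш(E/ℚ)[p] = 0` from a divisibility `char X ∣ L`, an algebraic leading-term SHAPE, and one `p`-adic valuation (cell `b2b-bsdres`)

HONEST FRAMING (run/shared/lean/b2b/bsd-rank1-residual/, verbatim): the goal of the cell is to
DELETE the COMBINATION-SHAPED residual classes for ALL analytic-rank `≤ 1` elliptic curves over `ℚ`
— "full BSD formula for every rank `≤ 1` curve in class C" assembled STRICTLY from published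
theorems — so that the rank-`≤ 1` remainder becomes exactly the CONSTRUCTION-SHAPED classes, which
are TYPED (missing-input `Prop`s), NOT attempted. This is not "finishing BSD".

Theorems only (no definition, no new named fact; pure `Λ = ℤ_p⟦T⟧` algebra plus Lagrange).
Companion of `Typed/KolyvaginCertificate.lean` (x11a gen 3) and of
`Wuthrich2014/PAdicBSDInequalityProofs.lean` (x1b gen 1), whose proof it abstracts.

**Why (class X11 at `p ≥ 5`, rank one; `b2b-bsdres-x11a/REPORT-g4.md`).** On the lane collector of
2026-08-18T19:14Z the rank-one X11-type pairs `(E, p)` with `p ‖ N`, `p ≥ 5`, `E[p]` irreducible,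
`N < 2·10⁴`, NOT closed by a Heegner-index certificate number 141 (85 residue pairs with `E`
non-semistable, 56 semistable `T-CAS` records). At 91 of them a Tamagawa number is divisible by `p`,
so — granted the BSD shape over the Heegner field (Gross–Zagier V (2.2)) — `p ∣ [E(K) : ℤ y_K]` for
EVERY Heegner field `K`: Kolyvagin's bound never certifies there, Jetchev's Tamagawa sharpening is
printed under `p ∤ N` only (referee A G28), and Kim's Kurihara-number formula needs the Tamagawa
defect `∂^{(∞)} = Σ ord_p c_ℓ` (Kim, Amer. J. Math. 2026, Conj. 1.10 — open). What IS in print for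
such pairs is the OTHER kind of argument — the one of Miller, LMS J. Comput. Math. 14 (2011)
Prop. 7.6 (the curve 1155k @ 7, `c_3 = c_5 = 7`, proof by Wuthrich): a divisibility
`char_Λ X(E/ℚ_∞) ∣ L_p(E)` (or `I · char ∣ L_p` at a split multiplicative `p`) in `Λ`
[for `p ‖ N` and a second ramified multiplicative prime: the full main conjecture, C. Skinner,
Pacific J. Math. 283 (2016) Thm. A; for semistable `E`: Kato's theorem as recorded by C. Wuthrich,
Doc. Math. 19 (2014) Cor. 19], the algebraic leading-term formula for `char X` at `T = 0`
[J. W. Jones, Duke Math. J. 59 (1989) 399–420 at multiplicative `p` — not held, acquisition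
acq-07893; P. Schneider, Invent. Math. 79 (1985) / BMS Math. Comp. 85 (2016) Thm. 1.7 at good
ordinary `p`, tree fact `Schneider1985_order_charGenerator`], and ONE per-curve `p`-adic computation
(order of vanishing of `L_p` and the valuation of its leading coefficient against the `p`-adic
regulator). None of the two class-level inputs at `p ‖ N` is a named fact of the tree today; this
file isolates, ONCE, the algebra that turns ANY such triple into the finite certificate
`Ш(E/ℚ)[p] = 0` consumed by `Typed/KolyvaginCertificate.lean` (`bsdp_of_shaAn_unit_of_noPTorsion`),
so that landing those facts later is bookkeeping. The hypotheses below are SHAPES (explicit data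
`fE, g, L, c, e, k, A, B, R`), not assertions about any particular `L`-function.

**The engine** (`padicValNat_card_shaPrimary_le_of_leadingTerm_shape`). Data: `fE` a generator of
(a principal ideal containing) `g`, i.e. `g ∈ (fE)` [the characteristic ideal and the divisibility
give this]; a power series `L ∈ ℚ_p⟦T⟧`, a constant `c ≠ 0` and `e : ℕ` with
`c · L = T^e · ι(g)` [`ι : Λ ↪ ℚ_p⟦T⟧`; `e = 1` encodes "`I · char`", `c = p^n` encodes a
divisibility in `Λ[1/p]`, `c = ϖ` a period ratio]; `k : ℕ` with `ord_{T=0} L = k + e` [computed];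
nonzero `p`-adic numbers `A` (local / Tamagawa / `𝓛`-type factors), `B` (normalisers such as
`log_p(κ(γ))^k · #E(ℚ)_tors²`) and `R` (a regulator) such that `T^k ∣ fE` and, IF `ord_{T=0} fE = k`,
then `Ш(E/ℚ)[p^∞]` is finite, `R ≠ 0` and `[T^k]fE · B = u · A · R · #Ш(E/ℚ)[p^∞]` for a unit
`u ∈ ℤ_p^×` [the leading-term theorem's shape: Perrin-Riou–Schneider, Jones]. Conclusion:
`Ш(E/ℚ)[p^∞]` is finite, `R ≠ 0`, `ord_{T=0} fE = k`, and
`ord_p #Ш(E/ℚ)[p^∞] + ord_p(A · R) ≤ ord_p(c · [T^{k+e}]L · B)`.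
Proof: `g = h · fE`, `fE = T^k · q`; comparing `T^{k+e}`-coefficients,
`c · [T^{k+e}]L = h(0) · q(0) ≠ 0`, so `q(0) = [T^k]fE ≠ 0`, `ord fE = k`, and `ord_p h(0) ≥ 0` is
the inequality. **The certificate** (`noPTorsion_of_leadingTerm_certificate`): if moreover
`ord_p(c · [T^{k+e}]L · B) = ord_p(A · R)` then `ord_p #Ш[p^∞] = 0`, hence (Lagrange) every
`p`-torsion class of `Ш(E/ℚ)` is `0` — the hypothesis `h` of gen 3's
`bsdp_of_shaAn_unit_of_noPTorsion`; `bsdp_of_leadingTerm_certificate` and the X11 instance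
`X11.bsdp_of_leadingTerm_certificate` compose the two (analytic rank `≤ 1`, `p ∤ #Ш_an`).

NOT a class theorem and NOT a new input: with `fE` a generator of `char_Λ X(E/ℚ_∞)` the shape is
DISCHARGED today only at a good ordinary `p ≥ 5` (x1b's files); at `p ‖ N` it names exactly what
remains to be typed (REPORT-g4.md §3): (i) the divisibility at `p ‖ N` — Skinner 2016 Thm. A on the
(ram) locus, Wuthrich 2014 Cor. 19 for semistable `E`, and NOTHING verbatim in print for
non-semistable `E` without a second ramified multiplicative prime (Skinner 2016 §2.5, arXiv
p. 11: "When `p ∣ N`, these inclusions do not follow directly from [Kato]"); (ii) Jones 1989. The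
semistable divisibility is now in the tree (`Wuthrich2014.corollary19_splitMultiplicative` p179618,
`corollary19_nonsplitMultiplicative` p179776, composed with this engine in
`Typed/PAdicCertificateSemistable.lean` p179945); the engine is unit-tested where both inputs are
tree facts (reducible good ordinary `p`, `Typed/PAdicCertificateReducible.lean`). Numerics (cell
jobs j041779, j042099, j042182; PARI 2.17 `ellpadicbsd`/`ellpadicregulator`, whose documentation
defines `Lp = Reg_p · #Ш` conjecturally): the printed 1155k@7 computation is reproduced digit for
digit; over the 141 rank-one `p ‖ N` pairs the `p`-adic analytic `Ш`, `S_p = Lp/Reg_p`, has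
`ord_p S_p = 0` at all 141 pairs (jobs j042099/j042317; one pair, 13398bk1@7, needed precision
`n ≥ 9`, job j042338): `S_p = 1 + O(p^k)` at 129 and `S_p = 2 + O(p^k)` exactly at 12 pairs, all
with `2⁴ ∣ N` — a 2-power normalisation inside PARI's modular-symbol quotient (complex
`#Ш_an = 1.000` in the same engine), `ord_p` untouched; CLOSED 2026-08-19 as an ENGINE
NORMALISATION (REFEREE R30.3): the literature seat's PARI-free modular-symbol engine
(`b2b-bsdres-lit/g7/msengine/`) gives `S = 1 + O(p^k)` at all 12, PARI's own untwisted route gives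
`1` at the two probed curves (pub-bsdpct job j044357, (d12) signed), and no valuation consumed by a
certificate theorem is affected — certificate VALUES, i.e. PREDICTIONS until (i)–(ii) are typed;
the lane owns verdicts.

References: Miller 2011 Prop. 7.6 [Miller2011LMS]; Skinner 2016 Thm. A [Skinner2016PacificMC];
Wuthrich 2014 Thm. 16, Cor. 19, Prop. 21 [Wuthrich2014]; Kato 2004 Thm. 17.4 [Kato2004Asterisque];
Jones, Duke Math. J. 59 (1989); Greenberg, LNM 1716 (1999) §4 pp. 110–113 [GreenbergLNM1716];
Balakrishnan–Müller–Stein 2016 Thm. 1.7 [BalakrishnanMullerStein2015]; Stein–Wuthrich, Math. Comp.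
82 (2013) [SteinWuthrich2013]; Kim, Amer. J. Math. (2026) Conj. 1.10 [Kim2022StructureSelmer].
-/

set_option autoImplicit false

noncomputable section

open scoped Classical

open WeierstrassCurve Literature.NumberTheory.EllipticCurves
  Literature.NumberTheory.EllipticCurves.Rank1Residual
  Literature.NumberTheory.EllipticCurves.Wuthrich2014

namespace Literature.NumberTheory.EllipticCurves.Rank1Residual.Typed

variable (W : WeierstrassCurve ℚ) [W.IsElliptic] (p : ℕ) [Fact p.Prime]

/-! ### The engine -/

omit [W.IsElliptic] in
/-- **The `p`-adic BSD inequality from a leading-term SHAPE** (abstracting x1b's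
`padicBSD_inequality_of_charIdeal_dvd`). Data and hypotheses as in the module docstring:
`g ∈ (fE)` in `Λ = ℤ_p⟦T⟧`; `c · L = T^e · ι g` with `c ≠ 0`; `ord_{T=0} L = k + e`; `T^k ∣ fE`;
and the leading-term shape at order `k` (`Ш[p^∞]` finite, `R ≠ 0`,
`[T^k]fE · B = u · A · R · #Ш[p^∞]`, `u ∈ ℤ_pˣ`) available as soon as `ord_{T=0} fE = k`.
Then `Ш(E/ℚ)[p^∞]` is finite, `R ≠ 0`, `ord_{T=0} fE = k` and
`ord_p #Ш(E/ℚ)[p^∞] + ord_p(A R) ≤ ord_p(c · [T^{k+e}]L · B)` (the defect is `ord_p h(0) ≥ 0` for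
the cofactor `h`, `g = h · fE`). Pure algebra; every input is explicit data. [folklore] -/
theorem padicValNat_card_shaPrimary_le_of_leadingTerm_shape (fE g : IwasawaAlgebra p)
    (hg : g ∈ Ideal.span {fE}) (L : PowerSeries ℚ_[p]) (c : ℚ_[p]) (hc : c ≠ 0) (e k : ℕ)
    (hι : PowerSeries.C c * L = PowerSeries.X ^ e * iwasawaToPowerSeries p g)
    (hordL : L.order = (k + e : ℕ)) (A B R : ℚ_[p]) (hA : A ≠ 0)
    (hXk : (PowerSeries.X : IwasawaAlgebra p) ^ k ∣ fE)
    (hLT : fE.order = (k : ℕ) →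
      Finite (AddCommGroup.primaryComponent W.sha p) ∧ R ≠ 0 ∧
        ∃ u : ℤ_[p]ˣ, ((PowerSeries.coeff k fE : ℤ_[p]) : ℚ_[p]) * B =
          ((u : ℤ_[p]) : ℚ_[p]) *
            (A * R * (Nat.card (AddCommGroup.primaryComponent W.sha p) : ℚ_[p]))) :
    Finite (AddCommGroup.primaryComponent W.sha p) ∧ R ≠ 0 ∧ fE.order = (k : ℕ) ∧
      (padicValNat p (Nat.card (AddCommGroup.primaryComponent W.sha p)) : ℤ) +
          (A * R).valuation ≤
        (c * PowerSeries.coeff (k + e) L * B).valuation := by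
  -- Step 1: the cofactor `h` with `g = h · fE`, and `fE = T^k · q`
  obtain ⟨h, hgh⟩ := Ideal.mem_span_singleton'.mp hg
  obtain ⟨q, hq⟩ := hXk
  -- Step 2: `[T^{k+e}](c L) = c [T^{k+e}] L = [T^k] ι g = h(0) q(0)` and `[T^k] fE = q(0)`
  have hcoeffL : PowerSeries.coeff (k + e) L ≠ 0 := by
    have hL0 : L ≠ 0 := by
      intro h0
      rw [h0, PowerSeries.order_zero] at hordL
      exact ENat.top_ne_coe _ hordL
    have h1 := PowerSeries.coeff_order hL0
    rwa [hordL, ENat.toNat_coe] at h1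
  have hcoeff_g : (PowerSeries.coeff k g : ℤ_[p]) =
      PowerSeries.constantCoeff h * PowerSeries.constantCoeff q := by
    rw [← hgh, hq, show h * (PowerSeries.X ^ k * q) = PowerSeries.X ^ k * (h * q) by ring,
      PowerSeries.coeff_X_pow_mul', if_pos le_rfl, Nat.sub_self,
      PowerSeries.coeff_zero_eq_constantCoeff, map_mul]
  have hcoeff_fE : (PowerSeries.coeff k fE : ℤ_[p]) = PowerSeries.constantCoeff q := by
    rw [hq, PowerSeries.coeff_X_pow_mul', if_pos le_rfl, Nat.sub_self,
      PowerSeries.coeff_zero_eq_constantCoeff]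
  have hcoeff_cL : c * PowerSeries.coeff (k + e) L =
      ((PowerSeries.coeff k g : ℤ_[p]) : ℚ_[p]) := by
    have h1 : PowerSeries.coeff (k + e) (PowerSeries.C c * L) = c * PowerSeries.coeff (k + e) L :=
      PowerSeries.coeff_C_mul _ _ _
    have h2 : PowerSeries.coeff (k + e) (PowerSeries.X ^ e * iwasawaToPowerSeries p g) =
        ((PowerSeries.coeff k g : ℤ_[p]) : ℚ_[p]) := by
      rw [PowerSeries.coeff_X_pow_mul', if_pos (Nat.le_add_left e k), Nat.add_sub_cancel,
        coeff_iwasawaToPowerSeries]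
    rw [← h1, hι, h2]
  -- hence `h(0) ≠ 0`, `q(0) ≠ 0`, `ord fE = k`
  have hg_k_ne : (PowerSeries.coeff k g : ℤ_[p]) ≠ 0 := by
    intro h0
    have : ((PowerSeries.coeff k g : ℤ_[p]) : ℚ_[p]) = 0 := by rw [h0]; rfl
    rw [← hcoeff_cL] at this
    exact (mul_ne_zero hc hcoeffL) this
  have hh0 : PowerSeries.constantCoeff h ≠ 0 := by
    intro h0; apply hg_k_ne; rw [hcoeff_g, h0, zero_mul]
  have hq0 : PowerSeries.constantCoeff q ≠ 0 := by
    intro h0; apply hg_k_ne; rw [hcoeff_g, h0, mul_zero]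
  have hordfE : fE.order = (k : ℕ) := by
    refine le_antisymm (PowerSeries.order_le k (by rw [hcoeff_fE]; exact hq0)) ?_
    refine PowerSeries.le_order fE k (fun i hi => ?_)
    have hik : ¬ k ≤ i := not_le.mpr (by exact_mod_cast hi)
    rw [hq, PowerSeries.coeff_X_pow_mul', if_neg hik]
  -- Step 3: the leading-term shape
  obtain ⟨hfin, hR, u, hu⟩ := hLT hordfE
  refine ⟨hfin, hR, hordfE, ?_⟩
  haveI := hfin
  -- Step 4: `c [T^{k+e}]L · B = h(0) · (u · A · R · #Ш[p^∞])` in `ℚ_p`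
  set h0 : ℚ_[p] := ((PowerSeries.constantCoeff h : ℤ_[p]) : ℚ_[p]) with hh0_def
  set Shp : ℚ_[p] := (Nat.card (AddCommGroup.primaryComponent W.sha p) : ℚ_[p]) with hShp_def
  have key : c * PowerSeries.coeff (k + e) L * B = h0 * (((u : ℤ_[p]) : ℚ_[p]) * ((A * R) * Shp)) := by
    have e1 : c * PowerSeries.coeff (k + e) L =
        h0 * ((PowerSeries.coeff k fE : ℤ_[p]) : ℚ_[p]) := by
      rw [hcoeff_cL, hcoeff_g, hcoeff_fE, hh0_def]; push_cast; ring
    calc c * PowerSeries.coeff (k + e) L * B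
        = h0 * (((PowerSeries.coeff k fE : ℤ_[p]) : ℚ_[p]) * B) := by rw [e1]; ring
      _ = h0 * (((u : ℤ_[p]) : ℚ_[p]) * ((A * R) * Shp)) := by rw [hu, hShp_def]
  -- Step 5: valuations
  have hh0ne : h0 ≠ 0 := by
    rw [hh0_def]; intro e0; exact hh0 (by exact_mod_cast (PadicInt.coe_eq_zero.mp e0))
  have hh0val : 0 ≤ h0.valuation := by rw [hh0_def]; exact PadicInt.valuation_coe_nonneg
  have hShp0 : Shp ≠ 0 := by rw [hShp_def]; exact_mod_cast Nat.card_pos.ne'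
  have hAR0 : A * R ≠ 0 := mul_ne_zero hA hR
  have hrhs0 : ((u : ℤ_[p]) : ℚ_[p]) * ((A * R) * Shp) ≠ 0 :=
    mul_ne_zero (coe_units_ne_zero p u) (mul_ne_zero hAR0 hShp0)
  have hval := congrArg Padic.valuation key
  rw [Padic.valuation_mul hh0ne hrhs0, Padic.valuation_mul (coe_units_ne_zero p u)
      (mul_ne_zero hAR0 hShp0), valuation_coe_units_eq_zero, zero_add,
    Padic.valuation_mul hAR0 hShp0] at hval
  have hvS : Shp.valuation =
      (padicValNat p (Nat.card (AddCommGroup.primaryComponent W.sha p)) : ℤ) := by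
    rw [hShp_def, Padic.valuation_natCast]
  rw [← hvS, hval]
  linarith

/-! ### The certificate -/

omit [W.IsElliptic] in
/-- **The per-curve `p`-adic certificate gives `Ш(E/ℚ)[p] = 0`.** In the situation of
`padicValNat_card_shaPrimary_le_of_leadingTerm_shape`, if the computed valuation of the normalised
leading coefficient EQUALS that of `A · R` — `ord_p(c · [T^{k+e}]L · B) = ord_p(A · R)`, the
"`p`-adic analytic order of `Ш` is a `p`-adic unit" — then `p ∤ #Ш(E/ℚ)[p^∞]`, so `Ш(E/ℚ)` has no
nonzero class killed by `p` (Lagrange in the finite group `Ш(E/ℚ)[p^∞]`): exactly the hypothesis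
`h` of `bsdp_of_shaAn_unit_of_noPTorsion` (`Typed/KolyvaginCertificate.lean`). The printed instance
of this argument at a multiplicative prime is Miller, LMS J. Comput. Math. 14 (2011) Prop. 7.6
(1155k @ 7). [cite: Miller2011LMS, Prop. 7.6] -/
theorem noPTorsion_of_leadingTerm_certificate (fE g : IwasawaAlgebra p)
    (hg : g ∈ Ideal.span {fE}) (L : PowerSeries ℚ_[p]) (c : ℚ_[p]) (hc : c ≠ 0) (e k : ℕ)
    (hι : PowerSeries.C c * L = PowerSeries.X ^ e * iwasawaToPowerSeries p g)
    (hordL : L.order = (k + e : ℕ)) (A B R : ℚ_[p]) (hA : A ≠ 0)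
    (hXk : (PowerSeries.X : IwasawaAlgebra p) ^ k ∣ fE)
    (hLT : fE.order = (k : ℕ) →
      Finite (AddCommGroup.primaryComponent W.sha p) ∧ R ≠ 0 ∧
        ∃ u : ℤ_[p]ˣ, ((PowerSeries.coeff k fE : ℤ_[p]) : ℚ_[p]) * B =
          ((u : ℤ_[p]) : ℚ_[p]) *
            (A * R * (Nat.card (AddCommGroup.primaryComponent W.sha p) : ℚ_[p])))
    (hcert : (c * PowerSeries.coeff (k + e) L * B).valuation = (A * R).valuation) :
    ∀ x : W.sha, (p : ℤ) • x = 0 → x = 0 := by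
  have hp : p.Prime := Fact.out
  obtain ⟨hfin, -, -, hle⟩ := padicValNat_card_shaPrimary_le_of_leadingTerm_shape W p fE g hg L c
    hc e k hι hordL A B R hA hXk hLT
  haveI := hfin
  set P := AddCommGroup.primaryComponent W.sha p
  have hv0 : padicValNat p (Nat.card P) = 0 := by
    have : (padicValNat p (Nat.card P) : ℤ) ≤ 0 := by rw [hcert] at hle; linarith
    exact_mod_cast le_antisymm this (by exact_mod_cast Nat.zero_le _)
  have hndvd : ¬ p ∣ Nat.card P := by
    rcases padicValNat.eq_zero_iff.mp hv0 with h1 | h0' | hnd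
    · exact absurd h1 hp.one_lt.ne'
    · exact absurd h0' Nat.card_pos.ne'
    · exact hnd
  intro x hx
  have hxn : p • x = 0 := by rw [← natCast_zsmul]; exact hx
  have hxP : x ∈ P := (AddCommGroup.mem_primaryComponent).2 ⟨1, by rw [pow_one]; exact hxn⟩
  -- the order of `⟨x, hxP⟩` divides `p` and `#P`, and `p ∤ #P`
  set y : P := ⟨x, hxP⟩
  have hpy : p • y = 0 := Subtype.ext (by simpa [y] using hxn)
  have hdiv : addOrderOf y ∣ p := addOrderOf_dvd_of_nsmul_eq_zero hpy
  rcases (Nat.dvd_prime hp).mp hdiv with h1 | hp'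
  · have hy0 : y = 0 := AddMonoid.addOrderOf_eq_one_iff.mp h1
    exact congrArg Subtype.val hy0
  · exact absurd (hp' ▸ addOrderOf_dvd_natCard y) hndvd

/-- **`BSD(E,p)` from the per-curve `p`-adic certificate at a pair of analytic rank `≤ 1` with
`p ∤ #Ш_an`** (composition with gen 3's `bsdp_of_shaAn_unit_of_noPTorsion`; GZK `hGZK`). The
divisibility (`hg`, `hι`) and the leading-term shape (`hXk`, `hLT`) are INPUTS — at `p ‖ N` they are
not named facts of the tree today (REPORT-g4.md §3) —; the computed data are `hordL` and `hcert`. Per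
curve; NOT a class theorem. [cite: Miller2011LMS, §1 Def. 1.1 and Prop. 7.6] -/
theorem bsdp_of_leadingTerm_certificate (hGZK : rank_eq_analyticRank_of_analyticRank_le_one)
    (fE g : IwasawaAlgebra p) (hg : g ∈ Ideal.span {fE}) (L : PowerSeries ℚ_[p]) (c : ℚ_[p])
    (hc : c ≠ 0) (e k : ℕ) (hι : PowerSeries.C c * L = PowerSeries.X ^ e * iwasawaToPowerSeries p g)
    (hordL : L.order = (k + e : ℕ)) (A B R : ℚ_[p]) (hA : A ≠ 0)
    (hXk : (PowerSeries.X : IwasawaAlgebra p) ^ k ∣ fE)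
    (hLT : fE.order = (k : ℕ) →
      Finite (AddCommGroup.primaryComponent W.sha p) ∧ R ≠ 0 ∧
        ∃ u : ℤ_[p]ˣ, ((PowerSeries.coeff k fE : ℤ_[p]) : ℚ_[p]) * B =
          ((u : ℤ_[p]) : ℚ_[p]) *
            (A * R * (Nat.card (AddCommGroup.primaryComponent W.sha p) : ℚ_[p])))
    (hcert : (c * PowerSeries.coeff (k + e) L * B).valuation = (A * R).valuation)
    (hr : W.analyticRank ≤ 1) {s : ℚ} (hs : shaAn W = (s : ℂ)) (hv : padicValRat p s = 0) :
    BSDp W p :=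
  bsdp_of_shaAn_unit_of_noPTorsion W p hGZK hr hs hv
    (noPTorsion_of_leadingTerm_certificate W p fE g hg L c hc e k hι hordL A B R hA hXk hLT hcert)

/-! ### Class X11 instance (canonical shape) -/

variable [W.IsGloballyMinimal]

/-- **X11 at an odd `p` with `p ∤ #Ш_an`: `BSD(E,p)` from the PUBLISHED facts of the canonical
signature (Wuthrich Prop. 21 `hW`, GZK, modularity) plus the per-curve `p`-adic certificate of this
file** (through gen 3's `X11.bsdp_of_shaAn_unit_of_noPTorsion`). At the 91 rank-one X11-type pairs
with `p ∣ ∏ c_q` (REPORT-g4.md §2) this is the ONLY certificate shape with a printed precedent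
(Miller 2011 Prop. 7.6); its two class-level inputs at `p ‖ N` are not yet named facts (§3).
SUB-class statement, per curve; NOT a deletion of X11. [cite: Miller2011LMS, Prop. 7.6]
[cite: Wuthrich2014, Prop. 21 (p. 400)] -/
theorem X11.bsdp_of_leadingTerm_certificate (hW : Wuthrich2014.sha_dvd_analyticSha)
    (hGZK : rank_eq_analyticRank_of_analyticRank_le_one) (hmod : hasEntireLFunction_rat)
    (hp : p ≠ 2) (hr : W.analyticRank ≤ 1) (hX : ClassX11 W p)
    (fE g : IwasawaAlgebra p) (hg : g ∈ Ideal.span {fE}) (L : PowerSeries ℚ_[p]) (c : ℚ_[p])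
    (hc : c ≠ 0) (e k : ℕ) (hι : PowerSeries.C c * L = PowerSeries.X ^ e * iwasawaToPowerSeries p g)
    (hordL : L.order = (k + e : ℕ)) (A B R : ℚ_[p]) (hA : A ≠ 0)
    (hXk : (PowerSeries.X : IwasawaAlgebra p) ^ k ∣ fE)
    (hLT : fE.order = (k : ℕ) →
      Finite (AddCommGroup.primaryComponent W.sha p) ∧ R ≠ 0 ∧
        ∃ u : ℤ_[p]ˣ, ((PowerSeries.coeff k fE : ℤ_[p]) : ℚ_[p]) * B =
          ((u : ℤ_[p]) : ℚ_[p]) *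
            (A * R * (Nat.card (AddCommGroup.primaryComponent W.sha p) : ℚ_[p])))
    (hcert : (c * PowerSeries.coeff (k + e) L * B).valuation = (A * R).valuation)
    {s : ℚ} (hs : shaAn W = (s : ℂ)) (hv : padicValRat p s = 0) : BSDp W p :=
  X11.bsdp_of_shaAn_unit_of_noPTorsion W p hW hGZK hmod hp hr hX hs hv
    (noPTorsion_of_leadingTerm_certificate W p fE g hg L c hc e k hι hordL A B R hA hXk hLT hcert)

end Literature.NumberTheory.EllipticCurves.Rank1Residual.Typed

end
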